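import Summits.AtomisticToContinuum.Crystallization.Theorems.ExcessDecayLiouvilleLinearSup

/-!
# Route `ExcessDecayLiouville`: pointwise bounds for CROSS-SUBLATTICE differences (linear levels, VI)

Linear half of the harmonic-replacement architecture for item `ExcessDecay` (stmt-AtomisticToContinuum-9334).
The two-point form of the tensor discrete Sobolev inequality on the lattice boxes at `x₀` and `x₀'`:

* `sup_sq_le_boxCrossSums` : `‖g x₀ − g x₀'‖²` is bounded by the weighted box sums of
  `‖(Δ^α g)(x₀ + A z) − (Δ^α g)(x₀' + A z)‖²` over the forward differences of orders `≤ 3` (any field `g`,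
  any two base points);
* `boxCrossSum_le` : for `x₀` on sublattice `0` such a box sum (second point `x₀ + (t 1 − t 0)`) is a
  cross-sublattice difference sum, bounded by `cross_sum_le`;
* `crossBox_step`, `crossCoeffs_le` : scalar bookkeeping for the cross bound (completed in
  `ExcessDecayLiouvilleLinearSupCrossBound`).

All `[folklore]`; helper lemmas, nothing here closes an item.
-/

noncomputable section

namespace Summit.AtomisticToContinuum.Crystallization.Theorems.ExcessDecayLiouville

open scoped BigOperators Topology InnerProductSpace RealInnerProductSpace Classical
open Literature.MathematicalPhysics.StatisticalMechanics
open Summit.AtomisticToContinuum.Crystallization.Theorems.PhononStabilityNegative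

-- Local notation: the force-constant map `K(e)w = h(|e|²)w + 2⟪e,w⟫h′(|e|²)e`.
local notation3 "𝕂[" e "] " w:max =>
  (-((‖e‖ ^ 2)⁻¹) ^ 7 + ((‖e‖ ^ 2)⁻¹) ^ 4) • w + (2 * ⟪e, w⟫ * (7 * ((‖e‖ ^ 2)⁻¹) ^ 8 - 4 * ((‖e‖ ^ 2)⁻¹) ^ 5)) • e
set_option quotPrecheck false in
local notation "𝟙ᵇ[" x ", " c ", " R "]" => (if dist (x : EuclideanSpace ℝ (Fin 3)) c ≤ R then (1 : ℝ) else 0)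
-- the three forward generators of `Λ₀` and the integer lattice vector
local notation "𝐮₁" => (triangularVec₁ 1 : EuclideanSpace ℝ (Fin 3))
local notation "𝐮₂" => (triangularVec₂ 1 : EuclideanSpace ℝ (Fin 3))
local notation "𝐰₃" => (layerNormal (2 * Real.sqrt (2 / 3)) : EuclideanSpace ℝ (Fin 3))
local notation "𝐳[" i ", " j ", " k "]" =>
  (((i : ℤ) : ℝ) • (triangularVec₁ 1 : EuclideanSpace ℝ (Fin 3)) + ((j : ℤ) : ℝ) • triangularVec₂ 1 +
    ((k : ℤ) : ℝ) • layerNormal (2 * Real.sqrt (2 / 3)))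
-- the constants of one level in mass form
local notation "Cₐ" => (19 * (1024 / ((23 / 25 : ℝ) ^ 3 * (23 / 25 : ℝ) ^ 3)) + 38 * (1024 / (23 / 25 : ℝ) ^ 3))
local notation "Cⱼ" => (9961472 : ℝ)

section

variable {t : Fin 2 → (EuclideanSpace ℝ (Fin 3))} {A : (EuclideanSpace ℝ (Fin 3)) →L[ℝ] (EuclideanSpace ℝ (Fin 3))}
  {c₀ : EuclideanSpace ℝ (Fin 3)} {κ : ℝ}

set_option quotPrecheck false in
-- Local notation: the operator row `(L v)(p)`.
local notation "𝕃" v:max " @ " p:max =>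
  tsum (fun q : Sites₀ t A => (if ((p : Sites₀ t A) : EuclideanSpace ℝ (Fin 3)) ≠ q then
    𝕂[((p : Sites₀ t A) : EuclideanSpace ℝ (Fin 3)) - q] (v ((p : Sites₀ t A) : EuclideanSpace ℝ (Fin 3)) - v q) else 0))
set_option quotPrecheck false in
-- local mass on the ball of radius `X` about the section centre `c₀`
local notation "𝐌[" f ", " X "]" =>
  tsum (fun p : Sites₀ t A => ‖f (p : EuclideanSpace ℝ (Fin 3))‖ ^ 2 * 𝟙ᵇ[p, c₀, X])
set_option quotPrecheck false in
-- weighted far mass with floor `Y` about `c₀`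
local notation "𝐉[" f ", " Y "]" =>
  tsum (fun q : Sites₀ t A => ‖f (q : EuclideanSpace ℝ (Fin 3))‖ ^ 2 * (max (dist (q : EuclideanSpace ℝ (Fin 3)) c₀) Y)⁻¹ ^ 8)
set_option quotPrecheck false in
-- lattice difference
local notation "Δ[" τ "] " f:max => (fun x : EuclideanSpace ℝ (Fin 3) => f (x + A τ) - f x)
set_option quotPrecheck false in
-- the level constant `L = (4Cₐ + 24Cⱼ)/κ + 1`
local notation "𝐋" => ((4 * Cₐ + 24 * Cⱼ) / κ + 1)
set_option quotPrecheck false in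
-- the box map based at `x₀` (a binder of each statement)
local notation "𝛗[" x₀ ", " i ", " j ", " k "]" => (x₀ + A 𝐳[((i : ℕ) : ℤ), ((j : ℕ) : ℤ), ((k : ℕ) : ℤ)])

/-! ## The two-point tensor inequality -/

/-- Weight identity for the box inequalities. [folklore] -/
theorem crossWeights_eq {R : ℝ} (hR : R ≠ 0) {S₀ S₁ S₂ S₃ S₁₂ S₂₃ S₁₃ S₁₂₃ : ℝ} :
    2 / R * (2 / R * (2 / R) * S₀ + 2 / R * (2 * R) * S₂ + 2 * R * (2 / R) * S₁ + 2 * R * (2 * R) * S₁₂) +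
      2 * R * (2 / R * (2 / R) * S₃ + 2 / R * (2 * R) * S₂₃ + 2 * R * (2 / R) * S₁₃ + 2 * R * (2 * R) * S₁₂₃) =
    8 / R ^ 3 * S₀ + 8 / R * (S₁ + S₂ + S₃) + 8 * R * (S₁₂ + S₂₃ + S₁₃) + 8 * R ^ 3 * S₁₂₃ := by
  field_simp
  ring

/-- **Two-point box inequality** (tensor discrete Sobolev inequality applied to `(i,j,k) ↦ g(x₀ + A z) − g(x₀' + A z)`):
for any field `g`, any base points `x₀, x₀'` and `R ≥ 1` (box side `⌊R⌋`), `‖g x₀ − g x₀'‖²` is at most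
`8R⁻³ Σ‖g φ − g φ'‖² + 8R⁻¹ Σ‖Δg φ − Δg φ'‖² + 8R Σ‖ΔΔg φ − ΔΔg φ'‖² + 8R³ Σ‖ΔΔΔg φ − ΔΔΔg φ'‖²`
(sums over the three generators, the three pairs and the triple). [folklore] -/
theorem sup_sq_le_boxCrossSums (g : (EuclideanSpace ℝ (Fin 3)) → (EuclideanSpace ℝ (Fin 3)))
    (x₀ x₀' : EuclideanSpace ℝ (Fin 3)) {R : ℝ} (hR : 1 ≤ R) :
    ‖g x₀ - g x₀'‖ ^ 2 ≤
      8 / R ^ 3 * (∑ k ∈ Finset.range (⌊R⌋₊ + 1), ∑ i ∈ Finset.range (⌊R⌋₊ + 1), ∑ j ∈ Finset.range (⌊R⌋₊ + 1),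
        ‖g 𝛗[x₀, i, j, k] - g 𝛗[x₀', i, j, k]‖ ^ 2) +
      8 / R * ((∑ k ∈ Finset.range (⌊R⌋₊ + 1), ∑ i ∈ Finset.range ⌊R⌋₊, ∑ j ∈ Finset.range (⌊R⌋₊ + 1),
        ‖(Δ[𝐮₁] g) 𝛗[x₀, i, j, k] - (Δ[𝐮₁] g) 𝛗[x₀', i, j, k]‖ ^ 2) +
        (∑ k ∈ Finset.range (⌊R⌋₊ + 1), ∑ i ∈ Finset.range (⌊R⌋₊ + 1), ∑ j ∈ Finset.range ⌊R⌋₊,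
        ‖(Δ[𝐮₂] g) 𝛗[x₀, i, j, k] - (Δ[𝐮₂] g) 𝛗[x₀', i, j, k]‖ ^ 2) +
        (∑ k ∈ Finset.range ⌊R⌋₊, ∑ i ∈ Finset.range (⌊R⌋₊ + 1), ∑ j ∈ Finset.range (⌊R⌋₊ + 1),
        ‖(Δ[𝐰₃] g) 𝛗[x₀, i, j, k] - (Δ[𝐰₃] g) 𝛗[x₀', i, j, k]‖ ^ 2)) +
      8 * R * ((∑ k ∈ Finset.range (⌊R⌋₊ + 1), ∑ i ∈ Finset.range ⌊R⌋₊, ∑ j ∈ Finset.range ⌊R⌋₊,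
        ‖(Δ[𝐮₂] (Δ[𝐮₁] g)) 𝛗[x₀, i, j, k] - (Δ[𝐮₂] (Δ[𝐮₁] g)) 𝛗[x₀', i, j, k]‖ ^ 2) +
        (∑ k ∈ Finset.range ⌊R⌋₊, ∑ i ∈ Finset.range (⌊R⌋₊ + 1), ∑ j ∈ Finset.range ⌊R⌋₊,
        ‖(Δ[𝐰₃] (Δ[𝐮₂] g)) 𝛗[x₀, i, j, k] - (Δ[𝐰₃] (Δ[𝐮₂] g)) 𝛗[x₀', i, j, k]‖ ^ 2) +
        (∑ k ∈ Finset.range ⌊R⌋₊, ∑ i ∈ Finset.range ⌊R⌋₊, ∑ j ∈ Finset.range (⌊R⌋₊ + 1),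
        ‖(Δ[𝐰₃] (Δ[𝐮₁] g)) 𝛗[x₀, i, j, k] - (Δ[𝐰₃] (Δ[𝐮₁] g)) 𝛗[x₀', i, j, k]‖ ^ 2)) +
      8 * R ^ 3 * (∑ k ∈ Finset.range ⌊R⌋₊, ∑ i ∈ Finset.range ⌊R⌋₊, ∑ j ∈ Finset.range ⌊R⌋₊,
        ‖(Δ[𝐰₃] (Δ[𝐮₂] (Δ[𝐮₁] g))) 𝛗[x₀, i, j, k] - (Δ[𝐰₃] (Δ[𝐮₂] (Δ[𝐮₁] g))) 𝛗[x₀', i, j, k]‖ ^ 2) := by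
  set n := ⌊R⌋₊ with hn
  have hR0 : 0 < R := by linarith
  have hn1 : R < (n : ℝ) + 1 := Nat.lt_floor_add_one R
  have hnR : (n : ℝ) ≤ R := Nat.floor_le hR0.le
  have hT := norm_sq_le_tensor_three (fun i j k => g 𝛗[x₀, i, j, k] - g 𝛗[x₀', i, j, k]) (n := ⌊R⌋₊) (Nat.zero_le n)
    (Nat.zero_le n) (Nat.zero_le n)
  have hz := boxPoint_succ (A := A) x₀
  have hz' := boxPoint_succ (A := A) x₀'
  have hzi : ∀ i j k : ℕ, 𝛗[x₀, i + 1, j, k] = 𝛗[x₀, i, j, k] + A 𝐮₁ := fun i j k => (hz i j k).1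
  have hzj : ∀ i j k : ℕ, 𝛗[x₀, i, j + 1, k] = 𝛗[x₀, i, j, k] + A 𝐮₂ := fun i j k => (hz i j k).2.1
  have hzk : ∀ i j k : ℕ, 𝛗[x₀, i, j, k + 1] = 𝛗[x₀, i, j, k] + A 𝐰₃ := fun i j k => (hz i j k).2.2
  have hzi' : ∀ i j k : ℕ, 𝛗[x₀', i + 1, j, k] = 𝛗[x₀', i, j, k] + A 𝐮₁ := fun i j k => (hz' i j k).1
  have hzj' : ∀ i j k : ℕ, 𝛗[x₀', i, j + 1, k] = 𝛗[x₀', i, j, k] + A 𝐮₂ := fun i j k => (hz' i j k).2.1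
  have hzk' : ∀ i j k : ℕ, 𝛗[x₀', i, j, k + 1] = 𝛗[x₀', i, j, k] + A 𝐰₃ := fun i j k => (hz' i j k).2.2
  have h000 : g 𝛗[x₀, 0, 0, 0] - g 𝛗[x₀', 0, 0, 0] = g x₀ - g x₀' := by
    simp only [Nat.cast_zero, Int.cast_zero, zero_smul, add_zero, map_zero]
  simp only [h000] at hT
  simp only [hzi, hzi'] at hT
  simp only [hzj, hzj'] at hT
  simp only [hzk, hzk'] at hT
  -- re-pair the seven difference box sums
  have e_j : ∑ k ∈ Finset.range (n + 1), ∑ i ∈ Finset.range (n + 1), ∑ j ∈ Finset.range n,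
        ‖((g (𝛗[x₀, i, j, k] + A 𝐮₂) - g (𝛗[x₀', i, j, k] + A 𝐮₂)) - (g 𝛗[x₀, i, j, k] - g 𝛗[x₀', i, j, k]))‖ ^ 2 =
      ∑ k ∈ Finset.range (n + 1), ∑ i ∈ Finset.range (n + 1), ∑ j ∈ Finset.range n,
        ‖(g (𝛗[x₀, i, j, k] + A 𝐮₂) - g 𝛗[x₀, i, j, k]) - (g (𝛗[x₀', i, j, k] + A 𝐮₂) - g 𝛗[x₀', i, j, k])‖ ^ 2 := by
    refine Finset.sum_congr rfl fun k _ => Finset.sum_congr rfl fun i _ => Finset.sum_congr rfl fun j _ => ?_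
    refine congrArg (fun v : EuclideanSpace ℝ (Fin 3) => ‖v‖ ^ 2) ?_
    abel
  have e_i : ∑ k ∈ Finset.range (n + 1), ∑ i ∈ Finset.range n, ∑ j ∈ Finset.range (n + 1),
        ‖((g (𝛗[x₀, i, j, k] + A 𝐮₁) - g (𝛗[x₀', i, j, k] + A 𝐮₁)) - (g 𝛗[x₀, i, j, k] - g 𝛗[x₀', i, j, k]))‖ ^ 2 =
      ∑ k ∈ Finset.range (n + 1), ∑ i ∈ Finset.range n, ∑ j ∈ Finset.range (n + 1),
        ‖(g (𝛗[x₀, i, j, k] + A 𝐮₁) - g 𝛗[x₀, i, j, k]) - (g (𝛗[x₀', i, j, k] + A 𝐮₁) - g 𝛗[x₀', i, j, k])‖ ^ 2 := by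
    refine Finset.sum_congr rfl fun k _ => Finset.sum_congr rfl fun i _ => Finset.sum_congr rfl fun j _ => ?_
    refine congrArg (fun v : EuclideanSpace ℝ (Fin 3) => ‖v‖ ^ 2) ?_
    abel
  have e_ij : ∑ k ∈ Finset.range (n + 1), ∑ i ∈ Finset.range n, ∑ j ∈ Finset.range n,
        ‖(((g (𝛗[x₀, i, j, k] + A 𝐮₂ + A 𝐮₁) - g (𝛗[x₀', i, j, k] + A 𝐮₂ + A 𝐮₁)) - (g (𝛗[x₀, i, j, k] + A 𝐮₂) - g (𝛗[x₀', i, j, k] + A 𝐮₂))) - ((g (𝛗[x₀, i, j, k] + A 𝐮₁) - g (𝛗[x₀', i, j, k] + A 𝐮₁)) - (g 𝛗[x₀, i, j, k] - g 𝛗[x₀', i, j, k])))‖ ^ 2 =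
      ∑ k ∈ Finset.range (n + 1), ∑ i ∈ Finset.range n, ∑ j ∈ Finset.range n,
        ‖((g (𝛗[x₀, i, j, k] + A 𝐮₂ + A 𝐮₁) - g (𝛗[x₀, i, j, k] + A 𝐮₂)) - (g (𝛗[x₀, i, j, k] + A 𝐮₁) - g 𝛗[x₀, i, j, k])) - ((g (𝛗[x₀', i, j, k] + A 𝐮₂ + A 𝐮₁) - g (𝛗[x₀', i, j, k] + A 𝐮₂)) - (g (𝛗[x₀', i, j, k] + A 𝐮₁) - g 𝛗[x₀', i, j, k]))‖ ^ 2 := by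
    refine Finset.sum_congr rfl fun k _ => Finset.sum_congr rfl fun i _ => Finset.sum_congr rfl fun j _ => ?_
    refine congrArg (fun v : EuclideanSpace ℝ (Fin 3) => ‖v‖ ^ 2) ?_
    abel
  have e_k : ∑ k ∈ Finset.range n, ∑ i ∈ Finset.range (n + 1), ∑ j ∈ Finset.range (n + 1),
        ‖((g (𝛗[x₀, i, j, k] + A 𝐰₃) - g (𝛗[x₀', i, j, k] + A 𝐰₃)) - (g 𝛗[x₀, i, j, k] - g 𝛗[x₀', i, j, k]))‖ ^ 2 =
      ∑ k ∈ Finset.range n, ∑ i ∈ Finset.range (n + 1), ∑ j ∈ Finset.range (n + 1),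
        ‖(g (𝛗[x₀, i, j, k] + A 𝐰₃) - g 𝛗[x₀, i, j, k]) - (g (𝛗[x₀', i, j, k] + A 𝐰₃) - g 𝛗[x₀', i, j, k])‖ ^ 2 := by
    refine Finset.sum_congr rfl fun k _ => Finset.sum_congr rfl fun i _ => Finset.sum_congr rfl fun j _ => ?_
    refine congrArg (fun v : EuclideanSpace ℝ (Fin 3) => ‖v‖ ^ 2) ?_
    abel
  have e_jk : ∑ k ∈ Finset.range n, ∑ i ∈ Finset.range (n + 1), ∑ j ∈ Finset.range n,
        ‖(((g (𝛗[x₀, i, j, k] + A 𝐰₃ + A 𝐮₂) - g (𝛗[x₀', i, j, k] + A 𝐰₃ + A 𝐮₂)) - (g (𝛗[x₀, i, j, k] + A 𝐮₂) - g (𝛗[x₀', i, j, k] + A 𝐮₂))) - ((g (𝛗[x₀, i, j, k] + A 𝐰₃) - g (𝛗[x₀', i, j, k] + A 𝐰₃)) - (g 𝛗[x₀, i, j, k] - g 𝛗[x₀', i, j, k])))‖ ^ 2 =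
      ∑ k ∈ Finset.range n, ∑ i ∈ Finset.range (n + 1), ∑ j ∈ Finset.range n,
        ‖((g (𝛗[x₀, i, j, k] + A 𝐰₃ + A 𝐮₂) - g (𝛗[x₀, i, j, k] + A 𝐰₃)) - (g (𝛗[x₀, i, j, k] + A 𝐮₂) - g 𝛗[x₀, i, j, k])) - ((g (𝛗[x₀', i, j, k] + A 𝐰₃ + A 𝐮₂) - g (𝛗[x₀', i, j, k] + A 𝐰₃)) - (g (𝛗[x₀', i, j, k] + A 𝐮₂) - g 𝛗[x₀', i, j, k]))‖ ^ 2 := by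
    refine Finset.sum_congr rfl fun k _ => Finset.sum_congr rfl fun i _ => Finset.sum_congr rfl fun j _ => ?_
    refine congrArg (fun v : EuclideanSpace ℝ (Fin 3) => ‖v‖ ^ 2) ?_
    abel
  have e_ik : ∑ k ∈ Finset.range n, ∑ i ∈ Finset.range n, ∑ j ∈ Finset.range (n + 1),
        ‖(((g (𝛗[x₀, i, j, k] + A 𝐰₃ + A 𝐮₁) - g (𝛗[x₀', i, j, k] + A 𝐰₃ + A 𝐮₁)) - (g (𝛗[x₀, i, j, k] + A 𝐮₁) - g (𝛗[x₀', i, j, k] + A 𝐮₁))) - ((g (𝛗[x₀, i, j, k] + A 𝐰₃) - g (𝛗[x₀', i, j, k] + A 𝐰₃)) - (g 𝛗[x₀, i, j, k] - g 𝛗[x₀', i, j, k])))‖ ^ 2 =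
      ∑ k ∈ Finset.range n, ∑ i ∈ Finset.range n, ∑ j ∈ Finset.range (n + 1),
        ‖((g (𝛗[x₀, i, j, k] + A 𝐰₃ + A 𝐮₁) - g (𝛗[x₀, i, j, k] + A 𝐰₃)) - (g (𝛗[x₀, i, j, k] + A 𝐮₁) - g 𝛗[x₀, i, j, k])) - ((g (𝛗[x₀', i, j, k] + A 𝐰₃ + A 𝐮₁) - g (𝛗[x₀', i, j, k] + A 𝐰₃)) - (g (𝛗[x₀', i, j, k] + A 𝐮₁) - g 𝛗[x₀', i, j, k]))‖ ^ 2 := by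
    refine Finset.sum_congr rfl fun k _ => Finset.sum_congr rfl fun i _ => Finset.sum_congr rfl fun j _ => ?_
    refine congrArg (fun v : EuclideanSpace ℝ (Fin 3) => ‖v‖ ^ 2) ?_
    abel
  have e_ijk : ∑ k ∈ Finset.range n, ∑ i ∈ Finset.range n, ∑ j ∈ Finset.range n,
        ‖((((g (𝛗[x₀, i, j, k] + A 𝐰₃ + A 𝐮₂ + A 𝐮₁) - g (𝛗[x₀', i, j, k] + A 𝐰₃ + A 𝐮₂ + A 𝐮₁)) - (g (𝛗[x₀, i, j, k] + A 𝐮₂ + A 𝐮₁) - g (𝛗[x₀', i, j, k] + A 𝐮₂ + A 𝐮₁))) - ((g (𝛗[x₀, i, j, k] + A 𝐰₃ + A 𝐮₂) - g (𝛗[x₀', i, j, k] + A 𝐰₃ + A 𝐮₂)) - (g (𝛗[x₀, i, j, k] + A 𝐮₂) - g (𝛗[x₀', i, j, k] + A 𝐮₂)))) - (((g (𝛗[x₀, i, j, k] + A 𝐰₃ + A 𝐮₁) - g (𝛗[x₀', i, j, k] + A 𝐰₃ + A 𝐮₁)) - (g (𝛗[x₀, i, j, k] + A 𝐮₁) - g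 (𝛗[x₀', i, j, k] + A 𝐮₁))) - ((g (𝛗[x₀, i, j, k] + A 𝐰₃) - g (𝛗[x₀', i, j, k] + A 𝐰₃)) - (g 𝛗[x₀, i, j, k] - g 𝛗[x₀', i, j, k]))))‖ ^ 2 =
      ∑ k ∈ Finset.range n, ∑ i ∈ Finset.range n, ∑ j ∈ Finset.range n,
        ‖(((g (𝛗[x₀, i, j, k] + A 𝐰₃ + A 𝐮₂ + A 𝐮₁) - g (𝛗[x₀, i, j, k] + A 𝐰₃ + A 𝐮₂)) - (g (𝛗[x₀, i, j, k] + A 𝐰₃ + A 𝐮₁) - g (𝛗[x₀, i, j, k] + A 𝐰₃))) - ((g (𝛗[x₀, i, j, k] + A 𝐮₂ + A 𝐮₁) - g (𝛗[x₀, i, j, k] + A 𝐮₂)) - (g (𝛗[x₀, i, j, k] + A 𝐮₁) - g 𝛗[x₀, i, j, k]))) - (((g (𝛗[x₀', i, j, k] + A 𝐰₃ + A 𝐮₂ + A 𝐮₁) - g (𝛗[x₀', i, j, k] + A 𝐰₃ + A 𝐮₂)) - (g (𝛗[x₀', i, j, k] + A 𝐰₃ + A 𝐮₁) - g (𝛗[x₀',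 i, j, k] + A 𝐰₃))) - ((g (𝛗[x₀', i, j, k] + A 𝐮₂ + A 𝐮₁) - g (𝛗[x₀', i, j, k] + A 𝐮₂)) - (g (𝛗[x₀', i, j, k] + A 𝐮₁) - g 𝛗[x₀', i, j, k])))‖ ^ 2 := by
    refine Finset.sum_congr rfl fun k _ => Finset.sum_congr rfl fun i _ => Finset.sum_congr rfl fun j _ => ?_
    refine congrArg (fun v : EuclideanSpace ℝ (Fin 3) => ‖v‖ ^ 2) ?_
    abel
  rw [e_j, e_i, e_ij, e_k, e_jk, e_ik, e_ijk] at hT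
  -- weights
  have hc₁ : (0 : ℝ) ≤ 2 / ((n : ℝ) + 1) := by positivity
  have hc₂ : (0 : ℝ) ≤ 2 * (n : ℝ) := by positivity
  have ha : 2 / ((n : ℝ) + 1) ≤ 2 / R := div_le_div_of_nonneg_left (by norm_num) hR0 hn1.le
  have hb : 2 * (n : ℝ) ≤ 2 * R := by linarith
  have nn3 : ∀ (a b c : ℕ) (F : ℕ → ℕ → ℕ → EuclideanSpace ℝ (Fin 3)),
      (0 : ℝ) ≤ ∑ k ∈ Finset.range a, ∑ i ∈ Finset.range b, ∑ j ∈ Finset.range c, ‖F i j k‖ ^ 2 :=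
    fun a b c F => Finset.sum_nonneg fun _ _ => Finset.sum_nonneg fun _ _ => Finset.sum_nonneg fun _ _ => sq_nonneg _
  have key := hT.trans (tensorWeights_le hc₁ hc₂ ha hb (nn3 _ _ _ _) (nn3 _ _ _ _) (nn3 _ _ _ _) (nn3 _ _ _ _)
    (nn3 _ _ _ _) (nn3 _ _ _ _) (nn3 _ _ _ _) (nn3 _ _ _ _) le_rfl le_rfl le_rfl le_rfl le_rfl le_rfl le_rfl le_rfl)
  rw [crossWeights_eq hR0.ne'] at key
  beta_reduce
  exact key

/-! ## Box cross sums are cross-sublattice difference sums -/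

/-- **A box cross sum is bounded by one cross level**: for `x₀` on sublattice `0`, ranges `a, b, c ≤ n + 1`,
`dist x₀ c₀ + 4n ≤ X`, `1 ≤ X`, and `f` finitely supported with zero rows on `dist · c₀ ≤ ρ_f`, `2X+2 ≤ ρ_f`,
`0 < Y ≤ 2X+2`:
`κ Σ_{k<a}Σ_{i<b}Σ_{j<c} ‖f(φ) − f(φ + (t 1 − t 0))‖² ≤ (Cₐ/X²) M(f; 4X+4) + Cⱼ J_Y(f)`. [folklore] -/
theorem boxCrossSum_le (hA : Adm₀ A) (hI : Inner₀ t A) (hκ0 : 0 ≤ κ)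
    (hκ : ∀ v : (EuclideanSpace ℝ (Fin 3)) → (EuclideanSpace ℝ (Fin 3)), (Function.support v).Finite →
      Function.support v ⊆ Sites₀ t A → κ * nnForm t A v ≤ ∑' p : Sites₀ t A, ⟪𝕃 v @ p, v p⟫)
    {f : (EuclideanSpace ℝ (Fin 3)) → (EuclideanSpace ℝ (Fin 3))} (hf : (Function.support f).Finite)
    {x₀ : EuclideanSpace ℝ (Fin 3)} (hx₀ : ∃ z ∈ Λ₀, x₀ = t 0 + A z) {n a b c : ℕ} (ha : a ≤ n + 1) (hb : b ≤ n + 1)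
    (hc : c ≤ n + 1) {X : ℝ} (hX : dist x₀ c₀ + 4 * n ≤ X) (hX1 : 1 ≤ X) {ρf : ℝ} (hρf : 2 * X + 2 ≤ ρf)
    (hharm : ∀ p : Sites₀ t A, dist (p : EuclideanSpace ℝ (Fin 3)) c₀ ≤ ρf → 𝕃 f @ p = 0)
    {Y : ℝ} (hY : 0 < Y) (hYX : Y ≤ 2 * X + 2) :
    κ * ∑ k ∈ Finset.range a, ∑ i ∈ Finset.range b, ∑ j ∈ Finset.range c,
        ‖f 𝛗[x₀, i, j, k] - f (𝛗[x₀, i, j, k] + (t 1 - t 0))‖ ^ 2 ≤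
      Cₐ / X ^ 2 * 𝐌[f, 4 * X + 4] + Cⱼ * 𝐉[f, Y] := by
  obtain ⟨z₀, hz₀, hxz⟩ := hx₀
  set I := Finset.range a ×ˢ (Finset.range b ×ˢ Finset.range c) with hIdef
  set ψ : ℕ × ℕ × ℕ → EuclideanSpace ℝ (Fin 3) := fun x => 𝛗[x₀, x.2.1, x.2.2, x.1] with hψ
  have hmemI : ∀ x ∈ I, x.1 ≤ n ∧ x.2.1 ≤ n ∧ x.2.2 ≤ n := by
    intro x hx
    simp only [hIdef, Finset.mem_product, Finset.mem_range] at hx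
    omega
  have hinj : Set.InjOn ψ I := by
    intro x _ y _ hxy
    obtain ⟨h1, h2, h3⟩ := boxPoint_injective hA x₀ hxy
    exact Prod.ext h3 (Prod.ext h1 h2)
  have heq : ∑ k ∈ Finset.range a, ∑ i ∈ Finset.range b, ∑ j ∈ Finset.range c,
      ‖f 𝛗[x₀, i, j, k] - f (𝛗[x₀, i, j, k] + (t 1 - t 0))‖ ^ 2 =
      ∑ y ∈ I.image ψ, ‖f y - f (y + (t 1 - t 0))‖ ^ 2 := by
    rw [Finset.sum_image hinj, hIdef, Finset.sum_product]
    refine Finset.sum_congr rfl fun k _ => ?_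
    rw [Finset.sum_product]
  rw [heq]
  refine cross_sum_le hA hI hκ0 hκ hf hX1 hρf hharm hY hYX _ fun y hy => ?_
  rw [Finset.mem_image] at hy
  obtain ⟨x, hx, rfl⟩ := hy
  obtain ⟨h1, h2, h3⟩ := hmemI x hx
  refine ⟨⟨z₀ + 𝐳[((x.2.1 : ℕ) : ℤ), ((x.2.2 : ℕ) : ℤ), ((x.1 : ℕ) : ℤ)],
    hcpLiouvilleLam_add_mem hz₀ (latticeVec_mem_Λ₀ _ _ _), ?_⟩, (dist_boxPoint_le hA x₀ c₀ h2 h3 h1).trans hX⟩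
  simp only [hψ, hxz, map_add]
  abel

/-- From one cross level to the level constant: `κ S ≤ (Cₐ/X²) M + Cⱼ J` gives `S ≤ (L/4)/X² M + (L/24) J`.
[folklore] -/
theorem crossBox_step (hκ0 : 0 < κ) {S M J X : ℝ} (h : κ * S ≤ Cₐ / X ^ 2 * M + Cⱼ * J) (hM : 0 ≤ M)
    (hJ : 0 ≤ J) : S ≤ 𝐋 / 4 / X ^ 2 * M + 𝐋 / 24 * J := by
  obtain ⟨-, hLa, -, hLj⟩ := levelConst_le (κ := κ) hκ0
  have h1 : S ≤ (Cₐ / X ^ 2 * M + Cⱼ * J) / κ := by rw [le_div_iff₀ hκ0, mul_comm]; exact h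
  have h2 : (Cₐ / X ^ 2 * M + Cⱼ * J) / κ = (Cₐ / κ) / X ^ 2 * M + (Cⱼ / κ) * J := by ring
  have ha : Cₐ / κ ≤ 𝐋 / 4 := by rw [le_div_iff₀ (by norm_num : (0:ℝ) < 4)]; rw [div_mul_eq_mul_div]; linarith
  have hj : Cⱼ / κ ≤ 𝐋 / 24 := by rw [le_div_iff₀ (by norm_num : (0:ℝ) < 24)]; rw [div_mul_eq_mul_div]; linarith
  have hX2 : 0 ≤ X ^ 2 := sq_nonneg _
  rw [h2] at h1
  calc S ≤ (Cₐ / κ) / X ^ 2 * M + (Cⱼ / κ) * J := h1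
    _ ≤ 𝐋 / 4 / X ^ 2 * M + 𝐋 / 24 * J := by
        gcongr

/-- Coefficient bookkeeping for the cross bound (`L, R ≥ 1`). [folklore] -/
theorem crossCoeffs_le {L R : ℝ} (hL : 1 ≤ L) (hR : 1 ≤ R) :
    8 / R ^ 3 * (L / 4 / R ^ 2) + 8 / R * (3 * (L ^ 2 / 4 / R ^ 4)) + 8 * R * (3 * (L ^ 3 / 4 / R ^ 6)) +
        8 * R ^ 3 * (L ^ 4 / 4 / R ^ 8) ≤ 16 * L ^ 4 / R ^ 5 ∧
      8 / R ^ 3 * (L / 24) + 8 / R * (3 * (L ^ 2 / 4 / R ^ 2 + L / 4)) + 8 * R * (3 * (7 * L ^ 3 / 4 / R ^ 2 + 3 * L / 2)) +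
        8 * R ^ 3 * (43 * L ^ 4 / 4 / R ^ 2 + 9 * L) ≤ 251 * L ^ 4 * R ^ 3 := by
  have hR0 : 0 < R := by linarith
  have hL0 : 0 ≤ L := by linarith
  have hL2 : L ≤ L ^ 2 := by nlinarith
  have hL3 : L ^ 2 ≤ L ^ 3 := by nlinarith
  have hL4 : L ^ 3 ≤ L ^ 4 := by nlinarith
  have hL14 : L ≤ L ^ 4 := hL2.trans (hL3.trans hL4)
  have hR31 : 1 ≤ R ^ 3 := one_le_pow₀ hR
  have hR3 : R ≤ R ^ 3 := by
    have := pow_le_pow_right₀ hR (by norm_num : 1 ≤ 3)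
    rwa [pow_one] at this
  constructor
  · have he : 8 / R ^ 3 * (L / 4 / R ^ 2) + 8 / R * (3 * (L ^ 2 / 4 / R ^ 4)) + 8 * R * (3 * (L ^ 3 / 4 / R ^ 6)) +
        8 * R ^ 3 * (L ^ 4 / 4 / R ^ 8) = (2 * L + 6 * L ^ 2 + 6 * L ^ 3 + 2 * L ^ 4) / R ^ 5 := by
      field_simp
      ring
    rw [he]
    exact div_le_div_of_nonneg_right (by nlinarith) (by positivity)
  · have hd1 : 8 / R ^ 3 ≤ 8 := div_le_self (by norm_num) hR31
    have hd2 : 8 / R ≤ 8 := div_le_self (by norm_num) hR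
    have hR2 : 1 ≤ R ^ 2 := one_le_pow₀ hR
    have e2 : L ^ 2 / 4 / R ^ 2 ≤ L ^ 2 / 4 := div_le_self (by positivity) hR2
    have e3 : 7 * L ^ 3 / 4 / R ^ 2 ≤ 7 * L ^ 3 / 4 := div_le_self (by positivity) hR2
    have e4 : 43 * L ^ 4 / 4 / R ^ 2 ≤ 43 * L ^ 4 / 4 := div_le_self (by positivity) hR2
    have q1 : 8 / R ^ 3 * (L / 24) ≤ L ^ 4 * R ^ 3 := by
      have : 8 / R ^ 3 * (L / 24) ≤ 8 * (L / 24) := mul_le_mul_of_nonneg_right hd1 (by positivity)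
      have : L ≤ L ^ 4 * R ^ 3 := by nlinarith
      linarith
    have q2 : 8 / R * (3 * (L ^ 2 / 4 / R ^ 2 + L / 4)) ≤ 12 * L ^ 4 * R ^ 3 := by
      have h1 : 8 / R * (3 * (L ^ 2 / 4 / R ^ 2 + L / 4)) ≤ 8 * (3 * (L ^ 2 / 4 / R ^ 2 + L / 4)) :=
        mul_le_mul_of_nonneg_right hd2 (by positivity)
      have : L ^ 2 ≤ L ^ 4 * R ^ 3 := by nlinarith
      have : L ≤ L ^ 4 * R ^ 3 := by nlinarith
      linarith
    have q3 : 8 * R * (3 * (7 * L ^ 3 / 4 / R ^ 2 + 3 * L / 2)) ≤ 78 * L ^ 4 * R ^ 3 := by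
      have h1 : 8 * R * (3 * (7 * L ^ 3 / 4 / R ^ 2 + 3 * L / 2)) ≤ 8 * R * (3 * (7 * L ^ 3 / 4 + 3 * L / 2)) := by
        gcongr
      have : R * L ^ 3 ≤ L ^ 4 * R ^ 3 := by nlinarith [mul_le_mul hR3 hL4 (by positivity) (by positivity)]
      have : R * L ≤ L ^ 4 * R ^ 3 := by nlinarith [mul_le_mul hR3 hL14 hL0 (by positivity)]
      nlinarith
    have q4 : 8 * R ^ 3 * (43 * L ^ 4 / 4 / R ^ 2 + 9 * L) ≤ 158 * L ^ 4 * R ^ 3 := by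
      have h1 : 8 * R ^ 3 * (43 * L ^ 4 / 4 / R ^ 2 + 9 * L) ≤ 8 * R ^ 3 * (43 * L ^ 4 / 4 + 9 * L) := by gcongr
      have : R ^ 3 * L ≤ L ^ 4 * R ^ 3 := by nlinarith [mul_le_mul_of_nonneg_left hL14 (by positivity : (0:ℝ) ≤ R ^ 3)]
      nlinarith
    have : 0 ≤ L ^ 4 * R ^ 3 := by positivity
    linarith

end

end Summit.AtomisticToContinuum.Crystallization.Theorems.ExcessDecayLiouville

end
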